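import Mathlib
import Summits.BirchSwinnertonDyer.Rank1Residual.X11b.UnitSaturationCertificate

/-!
# BSD rank-≤1 residual cell, class X11b @ 3 — SOCLE INDEPENDENCE from the character matrix (analytic road, (C3b) ⇐ (C2) + exact identities)

HONEST FRAMING (cell `b2b-bsdres-*`): this file books NOTHING; it is the elementary algebra that DISCHARGES the hypothesis `hind`
(resp. `hnot`) of `X11b/SClassCertificate.sclass_certificate₂` (resp. `sclass_certificate`) from what an analytic-road record actually
holds (referee A R227.5 (α): "the non-principality of the socle products must come from the certified side — the cubic-residue-
character obstruction — never from a `bnfinit` class-group read"). Additive notation: `M = Additive A^×` (the multiplicative group of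
the octic), `I` = the group of fractional ideals, `D : M →+ I` the divisor map (`x ↦ (x)`), so `U = ker D` = units and
`Cl(A) = I ⧸ range D`; `T = μ(A)` (finite, `p ∤ #T`), `u_l` the certified units with (C2) `p ∤ k`, `k•U ⊆ T ⊔ ⟨u_l⟩`
(`exists_mem_sup_add_nsmul_of_coprime` turns this into `U ⊆ (T ⊔ ⟨u_l⟩) + p•M`); `β_j` the EXACT generators
`D β_j = (c·p^(s_j+1)) • A_j` of the powers of the `S`-supported ideals `A_j` (`s_j + 1 = v_j`); `χ_i : M →+ ZMod p` the residue
characters with full column rank on the JOINT family `(u_1 … u_n, β_1 … β_t)` (`Fin.append u β`). CONCLUSION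
(`socle_indep_of_charMatrix`): a relation `∑ a_j (c p^{s_j}) • A_j ∈ range D` with `a_j < p` forces every `a_j = 0`, i.e. the socle
classes `[c p^{s_j} A_j] = y_j^(p^(v_j - 1))` (`y_j = [c•A_j]`) are `𝔽_p`-independent in `Cl(A)` — which is `hind`.
Pure algebra; no number theory is formalised here. X11 ∧ r = 1 ∧ p = 3 stays CONSTRUCTION-SHAPED (R6.2); not "finishing BSD".
-/

namespace Summit.BirchSwinnertonDyer.Rank1Residual.X11b.SocleIndependenceCertificate

open Finset Summit.BirchSwinnertonDyer.Rank1Residual.X11b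

variable {M I : Type*} [AddCommGroup M] [AddCommGroup I] {p : ℕ} [hp : Fact p.Prime] {n m t : ℕ}

omit hp in
/-- From (C2) in the form a record holds it — an integer `k` prime to `p` (the unit index) with `k•ε ∈ H` for every unit `ε`
(Lagrange in `U/H`) — every unit is an element of `H` plus a `p`-th multiple (Bézout). -/
theorem exists_mem_add_nsmul_of_coprime (D : M →+ I) (H : AddSubgroup M) (k : ℕ) (hk : Nat.Coprime p k)
    (hkU : ∀ ε : M, D ε = 0 → k • ε ∈ H) (ε : M) (hε : D ε = 0) : ∃ h ∈ H, ∃ w : M, ε = h + p • w := by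
  obtain ⟨a, b, hab⟩ := (Nat.isCoprime_iff_coprime.mpr hk : IsCoprime (p : ℤ) (k : ℤ))
  refine ⟨b • (k • ε), H.zsmul_mem (hkU ε hε) b, a • ε, ?_⟩
  have h1 : ε = ((a * p + b * k : ℤ)) • ε := by rw [hab, one_zsmul]
  calc ε = ((a * p + b * k : ℤ)) • ε := h1
    _ = b • (k • ε) + p • (a • ε) := by
        rw [add_zsmul, mul_comm a, mul_zsmul, mul_zsmul, natCast_zsmul, natCast_zsmul, add_comm]

/-- **Socle independence from the joint character matrix (R227.5 (α)).** See the module docstring for the dictionary. If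
`∑_j (a_j · c · p^{s_j}) • A_j = D γ` with all `a_j < p`, then all `a_j = 0`. Proof: `D(∑ a_j•β_j) = p • D γ`, so
`ε := ∑ a_j•β_j − p•γ` is a unit, `ε = t₀ + ∑ e_l•u_l + p•w`; every character kills `t₀` and `p`-multiples, so
`∑ a_j χ(β_j) − ∑ e_l χ(u_l) = 0` for all `χ`, and full column rank of the joint matrix gives `a_j ≡ 0 (mod p)`. -/
theorem socle_indep_of_charMatrix (D : M →+ I) (T : AddSubgroup M) [Finite T] (hT : ¬ p ∣ Nat.card T)
    (u : Fin n → M) (β : Fin t → M) (χ : Fin m → M →+ ZMod p)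
    (hind : ∀ e : Fin (n + t) → ZMod p, (∀ i, ∑ j, e j * χ i (Fin.append u β j) = 0) → e = 0)
    (hU : ∀ ε : M, D ε = 0 → ∃ h ∈ T ⊔ AddSubgroup.closure (Set.range u), ∃ w : M, ε = h + p • w)
    (A : Fin t → I) (c : ℕ) (s : Fin t → ℕ) (hβ : ∀ j, D (β j) = (c * p ^ (s j + 1)) • A j)
    (a : Fin t → ℕ) (ha : ∀ j, a j < p) (hrel : ∃ γ : M, ∑ j, (a j * (c * p ^ (s j))) • A j = D γ) :
    ∀ j, a j = 0 := by
  obtain ⟨γ, hγ⟩ := hrel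
  -- `D (∑ a_j • β_j) = D (p • γ)`
  have hD : D (∑ j, a j • β j) = D (p • γ) := by
    rw [map_nsmul, ← hγ, map_sum, Finset.smul_sum]
    refine Finset.sum_congr rfl (fun j _ => ?_)
    rw [map_nsmul, hβ j, smul_smul, smul_smul]
    congr 1
    ring
  -- the unit `ε`
  set ε : M := ∑ j, a j • β j - p • γ with hεdef
  have hε : D ε = 0 := by rw [hεdef, map_sub, hD, sub_self]
  obtain ⟨h, hh, w, hw⟩ := hU ε hε
  obtain ⟨t₀, ht₀, c₀, hc₀, htc⟩ := AddSubgroup.mem_sup.mp hh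
  obtain ⟨e, rfl⟩ := AddSubgroup.mem_closure_range_iff_of_fintype.mp hc₀
  -- apply the characters
  have hchar : ∀ i, (∑ j, (a j : ZMod p) * χ i (β j)) - ∑ l, (e l : ZMod p) * χ i (u l) = 0 := by
    intro i
    have h1 : χ i ε = ∑ j, (a j : ZMod p) * χ i (β j) := by
      rw [hεdef, map_sub, map_nsmul, nsmul_eq_mul (p : ℕ), CharP.cast_eq_zero, zero_mul, sub_zero, map_sum]
      refine Finset.sum_congr rfl (fun j _ => ?_)
      rw [map_nsmul, nsmul_eq_mul]
    have h2 : χ i ε = ∑ l, (e l : ZMod p) * χ i (u l) := by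
      rw [hw, ← htc, map_add, map_add, UnitSaturationCertificate.char_eq_zero_of_mem_finite T hT (χ i) ht₀, zero_add, map_nsmul,
        nsmul_eq_mul (p : ℕ), CharP.cast_eq_zero, zero_mul, add_zero, map_sum]
      refine Finset.sum_congr rfl (fun l _ => ?_)
      rw [map_zsmul, zsmul_eq_mul]
    rw [← h1, ← h2, sub_self]
  -- the joint coefficient vector
  let E : Fin (n + t) → ZMod p := Fin.append (fun l => -((e l : ℤ) : ZMod p)) (fun j => ((a j : ℕ) : ZMod p))
  have hE : ∀ i, ∑ k, E k * χ i (Fin.append u β k) = 0 := by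
    intro i
    rw [Fin.sum_univ_add]
    simp only [E, Fin.append_left, Fin.append_right]
    have := hchar i
    rw [sub_eq_zero] at this
    simp only [neg_mul, Finset.sum_neg_distrib]
    rw [← this, this, neg_add_cancel]
  have hE0 : E = 0 := hind E hE
  intro j
  have hj : ((a j : ℕ) : ZMod p) = 0 := by
    have := congrFun hE0 (Fin.natAdd n j)
    simpa only [E, Fin.append_right, Pi.zero_apply] using this
  rw [CharP.cast_eq_zero_iff (ZMod p) p] at hj
  exact Nat.eq_zero_of_dvd_of_lt hj (ha j)

end Summit.BirchSwinnertonDyer.Rank1Residual.X11b.SocleIndependenceCertificate
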